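import Summits.QuantumFields.YangMills.Theorems.UnitScaleTiltProp7KRows78EtaTJFamilyPackage
import Summits.QuantumFields.YangMills.Theorems.UnitScaleTiltProp7KinvEtaTJFamilyPackageAllMembers
import Summits.QuantumFields.YangMills.Theorems.UnitScaleTiltProp7KernelCDoorOfKinvEntry
import Summits.QuantumFields.YangMills.Theorems.UnitScaleTiltProp7Kernel137DoorOfKinvEntry
import Summits.QuantumFields.YangMills.Theorems.UnitScaleTiltProp7GreenEtaTJBlockColumn
import HarnessLib

/-!
# Route `UnitScaleTilt`, crux K1 «MinimiserStabilityRegPr» (stmt-QuantumFields-19200), EX face — K-STOREY, FILE (K7 = ROWS (7) `hCk` AND (8) `h137kΔ` AS `∃`-PACKAGES):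
# **THE C-KERNEL ROW `hCk` AND THE COARSE-DEFECT ROW `h137kΔ` OF S47 AT THE J-SLOT `S_J := Δ^η + T_Jᴾ`, FOR ALL MEMBERS, WITH L-ONLY CONSTANTS** — px10 g13's doors
# ✓`Prop7KernelCDoorOfKinvEntry.kernelC_family_of_kinvRow_of_greenColumn` (row (7)) and ✓`Prop7Kernel137DoorOfKinvEntry.kernel137_family_of_kinvRow` (row (8)) fed the J-slot
# closure ✓`Prop7KinvEtaTJFamilyPackageAllMembers.kinvRow_etaTJ_family_exists_allMembers` (K6-J), plus — for (7) — the block COLUMN of `G_S`, the chair's ✓`Prop7GreenEtaTJBlockColumn.blockColumn_GT_etaTJ_of_letters`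
# ((F) ✓`hGblk_etaTJ_of_letters` by px16's duality ✓`sum_norm_symm_apply_single_le_of_isSymmetric`, `G_S` symmetric), fed the weighted letters and the symmetry row of `T_Jᴾ` (✓`TJP_rows_at_regPr`)

Cell `ym3-torus` (HUMAN RULING D-0037; rung R3 = SU(2) YM₃ on T³ — NOT d = 4, NOT infinite volume, NOT a mass gap, NOT Clay).  Width seat `ym3-torus-px10` (gen 15; FREE px; R-edition
2026-08-30 15:30Z = ROOM-FREE `_allMembers` EDITION of ✓`Prop7KRows78EtaTJFamilyPackage`, generated from ✓p776972's bytes by script: ROOM lines deleted, suppliers K6-J∕T1∕T2∕h133 swapped to their `_allMembers` editions, §1 `open`ed not re-declared; ★p1 g28 WORD №47 (c), ★★OWNER 17cz ∕ WORD №105).  THEOREMS ONLY (0 `def`, 0 `sorry`, default heartbeats); `--supports stmt-QuantumFields-19200 --as helper`; count-neutral.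

THE PRINT.  [Balaban1985Variational] (133)∕(137) p. 298: the kernels of `C = Q G Δ₁ G Q*`-type operators and of the coarse defect `(QGQ*)⁻¹ − a` decay exponentially on the unit
(block) scale, uniformly in `k`; [Balaban1985BackgroundPropagators] (3.132) p. 422 (the coarse inverse), (3.126)–(3.128) pp. 420–421 (`H`, `T_J`), Thm 3.12 p. 423 (the
`e^{−δ·dist}` localisation of `G`).  Everything here is an `∃`-assembly over landed doors — the estimates of print are the doors' inputs, all discharged by name.

WHAT IS PROVED (ns `Summit.QuantumFields.YangMills.Theorems.Prop7KRows78EtaTJFamilyPackage`).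
* §1 (re-used from ✓`Prop7KRows78EtaTJFamilyPackage` by `open`, not re-declared) ★★ `blockColumn_GT_etaTJ_of_blockLetter_of_supRow` — MEMBER: the C-door's `hGcol` text at `S_J` (the `ℓ¹` sum over ONE block of the column of `G_S` from a point source,
  constant `4·(BV·V)`, rate `δ`) from the block-supported `G₀`-value letter (rate `δ₁`, constant `BV`) and the sup row of `T_Jᴾ` (constant `k`), `δ + ν ≤ δ₁`, window
  `BV·V·(k·e^{δ}) ≤ ½` — the chair's ✓`blockColumn_GT_etaTJ_of_letters` fed ✓`weighted_of_blockSupported`, ✓`hTw_of_supRow` and ✓`TJP_rows_at_regPr` (symmetry of `T_Jᴾ`).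
* §2 ★★★ `hCk_family_exists_allMembers` — THERE ARE L-only `αC CC δC : ℕ → ℝ` (cap with the three windows of record and `≤ 1`, `0 ≤ CC`, `0 < δC`) such that under `RegPr ρ U₀`, `ρ ≤ αC L`,
  `Lift` (every member — NO ROOM) and the coupling window: THE S47 ROW TEXT of `hCk` at `S_J` — `‖toL2⁻¹(Q_k† K_J⁻¹ Q_k G_S (δ_b ⊗ Z))(bd)‖ ≤ CC L·ℓ⁻³·e^{−δC L·tdist(B bd₋... )}·‖Z‖`.
* §3 ★★★ `h137kDelta_family_exists_allMembers` — likewise THE S47 ROW TEXT of `h137kΔ` at `S_J` — `‖toL2⁻¹(Q_k†(K_J⁻¹ − a)(δ_y ⊗ Z))(b)‖ ≤ CKΔ L·e^{−δKΔ L·tdist(B b₋, ŷ)}·‖Z‖`.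
HONEST SCOPE.  `∃`-assemblies; no estimate of print is proved HERE; ROOM-FREE (K6-J, `h133`, T1, T2 enter in their `_allMembers` editions); rows (7)(8) are TWO of S47's rows — nothing of the other rows, EX
or the crux is proved; the Yang–Mills mass gap is NOT proved.

References: T. Bałaban, CMP **99** (1985) 389–434 [Balaban1985BackgroundPropagators] ((3.126)–(3.132) pp.420–422, (3.137) p.423, Thm 3.12 p.423); CMP **102** (1985) 277–309
[Balaban1985Variational] ((133), (137) p.298, (110)–(111) p.294).
-/

set_option autoImplicit false

noncomputable section

open scoped BigOperators Matrix.Norms.L2Operator InnerProductSpace ComplexConjugate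

namespace Summit.QuantumFields.YangMills.Theorems.Prop7KRows78EtaTJFamilyPackageAllMembers

open Literature.MathematicalPhysics.QuantumFieldTheory.Balaban1983to89
open Literature.MathematicalPhysics.QuantumFieldTheory.Balaban1983to89.T3ContinuumYM3Torus
open Literature.MathematicalPhysics.QuantumFieldTheory.Balaban1983to89.T3Thm1Carrier
open T3PrintedRegularMinimiser (RegPr)
open T3PrintedMinimiserExistence (regPr_mono)
open T3PrintedRegularOrbits (sites_eq)
open T3LevelShift (siteShift)
open T3SectALandauChart (bgUnits)
open B15DeterminingSets (embIter)
open B9Eq311L2Pairing (WL2)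
open B11Eq103H1Complex (BondL2K)
open B5Eq118OneStroke (iterBlockOf)
open Summit.QuantumFields.YangMills.Theorems.Prop8Chart (emlIterU)
open Summit.QuantumFields.YangMills.Theorems.Prop7SectET3Transport (periodsT3)
open Summit.QuantumFields.YangMills.Theorems.Prop7SectET3HilbertLetters (W₂ toL2 toL2B)
open Summit.QuantumFields.YangMills.Theorems.Prop7SectET3WilsonHessian (DeltaEtaSlot)
open Summit.QuantumFields.YangMills.Theorems.Prop7SectET3CurvedPropagators (GT KinvT PosOnto Qk)
open Summit.QuantumFields.YangMills.Theorems.Prop7SectET3DeltaOnePInv (TJSlotP)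
open Summit.QuantumFields.YangMills.Theorems.Prop7SectET3RealityPInvJTerm (TJP_rows_at_regPr)
open Summit.QuantumFields.YangMills.Theorems.Prop7OneFormCoerciveHolds (hco_DeltaEtaSlot_exists posOnto_of_coercive)
open Summit.QuantumFields.YangMills.Theorems.Prop7Kernel133OfPiBlockLetters (coarseRow_mono_rate)
open Summit.QuantumFields.YangMills.Theorems.Prop7KinvEtaTJFamilyPackageAllMembers (kinvRow_etaTJ_family_exists_allMembers)
open Summit.QuantumFields.YangMills.Theorems.Prop7H133FamilyPackageAllMembers (h133_family_exists_allMembers)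
open Summit.QuantumFields.YangMills.Theorems.Prop7GreenEtaTJBlockColumn (blockColumn_GT_etaTJ_of_letters)
open Summit.QuantumFields.YangMills.Theorems.Prop7TJRowsFamilyOfH133AllMembers (tjValueRows_family_of_h133_allMembers)
open Summit.QuantumFields.YangMills.Theorems.Prop7CoerciveDeltaOnePJOfTJSupRowAllMembers (hco_DeltaEtaTJ_exists_of_tjSupLin_allMembers)
open Summit.QuantumFields.YangMills.Theorems.Prop7KRows78EtaTJFamilyPackage (blockColumn_GT_etaTJ_of_blockLetter_of_supRow)
open Summit.QuantumFields.YangMills.Theorems.Prop7OneFormGreenBlockSupFamily (blockSup_GT_DeltaEtaSlot_family)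
open Summit.QuantumFields.YangMills.Theorems.Prop7GreenPiBlockLettersEdition (weighted_of_blockSupported)
open Summit.QuantumFields.YangMills.Theorems.Prop7TJWeightedRowsOfUnweighted (hTw_of_supRow)
open Summit.QuantumFields.YangMills.Theorems.Prop7KernelCDoorOfKinvEntry (kernelC_family_of_kinvRow_of_greenColumn)
open Summit.QuantumFields.YangMills.Theorems.Prop7Kernel137DoorOfKinvEntry (kernel137_family_of_kinvRow)

/-! ## §2 Row (7) `hCk` at `S_J` for all members, `∃`-packaged -/

section Family

/-- ★★★ **THE S47 ROW `hCk` AT THE J-SLOT FOR ALL MEMBERS AS ONE `∃`-PACKAGE** — px10 g13's C-door ✓`kernelC_family_of_kinvRow_of_greenColumn` at `Δx := DeltaEtaSlot … + TJSlotP … a` fed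
K6-J ✓`kinvRow_etaTJ_family_exists_allMembers` (the coarse row, lowered to the common rate) and §1's block column (⟸ ✓`blockSup_GT_DeltaEtaSlot_family`, (T1) ✓`tjValueRows_family_of_h133_allMembers` ∘
✓`h133_family_exists_allMembers`, (T2) ✓`hco_DeltaEtaTJ_exists_of_tjSupLin_allMembers`, (γ) ✓`hco_DeltaEtaSlot_exists`); cap closing (F)'s window by `min`; `CC L·ℓ⁻³`, rate `δC L`.
[cite: Balaban1985Variational, (133), (137) p.298; Balaban1985BackgroundPropagators, (3.132) p.422, Thm 3.12 p.423] -/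
theorem hCk_family_exists_allMembers [hFL : ∀ F : T3Family, Fact (0 < (F.L : ℝ))] [hFη : ∀ (F : T3Family) (k : ℕ), Fact (0 < ((F.L : ℝ)⁻¹) ^ k)]
    (c₀ cB : ℕ → ℝ) [hc₀ : ∀ L : ℕ, Fact (0 < c₀ L)] [hcB : ∀ L : ℕ, Fact (0 < cB L)] {a₀ a₁ : ℝ} (ha₀ : 0 < a₀) (ha₀₁ : a₀ ≤ a₁) :
    ∃ (αC CC δC : ℕ → ℝ),
      (∀ L : ℕ, 1 < L → 0 < αC L) ∧ (∀ L : ℕ, 1 < L → 10 ^ 12 * (L : ℝ) ^ 3 * αC L ≤ 1) ∧ (∀ L : ℕ, 1 < L → 10 ^ 10 * (L : ℝ) ^ 6 * αC L ≤ 1) ∧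
      (∀ L : ℕ, 1 < L → 13 * 10 ^ 14 * (L : ℝ) ^ 3 * αC L ≤ 1) ∧ (∀ L : ℕ, 1 < L → αC L ≤ 1) ∧ (∀ L : ℕ, 1 < L → 0 ≤ CC L) ∧ (∀ L : ℕ, 1 < L → 0 < δC L) ∧
    ∀ (L : ℕ), 1 < L → ∀ (i : Idx L) (U₀ : GaugeField (i.1.1.P i.1.2.2) 0 (Matrix.specialUnitaryGroup (Fin 2) ℂ)), ∀ ρ : ℝ, RegPr i.1.1 i.1.2.1 i.1.2.2 ρ U₀ → ρ ≤ αC L →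
        (∀ cf : Site (i.1.1.P i.1.2.2) (i.1.2.2 - i.1.2.1) → Matrix (Fin 2) (Fin 2) ℂ,
        (∀ e' : PBond (i.1.1.P i.1.2.2) (i.1.2.2 - i.1.2.1), cf e'.src = ((emlIterU (i.1.2.2 - i.1.2.1) (bgUnits i.1.1 i.1.2.2 U₀) e' : (Matrix (Fin 2) (Fin 2) ℂ)ˣ) : Matrix (Fin 2) (Fin 2) ℂ) * cf e'.tgt *
        (((emlIterU (i.1.2.2 - i.1.2.1) (bgUnits i.1.1 i.1.2.2 U₀) e')⁻¹ : (Matrix (Fin 2) (Fin 2) ℂ)ˣ) : Matrix (Fin 2) (Fin 2) ℂ)) →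
        ∃ l₀ : Site (i.1.1.P i.1.2.2) 0 → Matrix (Fin 2) (Fin 2) ℂ,
        (∀ b' : PBond (i.1.1.P i.1.2.2) 0, l₀ b'.src = ((bgUnits i.1.1 i.1.2.2 U₀ b' : (Matrix (Fin 2) (Fin 2) ℂ)ˣ) : Matrix (Fin 2) (Fin 2) ℂ) * l₀ b'.tgt * (((bgUnits i.1.1 i.1.2.2 U₀ b')⁻¹ : (Matrix (Fin 2) (Fin 2) ℂ)ˣ) : Matrix (Fin 2) (Fin 2) ℂ)) ∧
        ∀ y : Site (i.1.1.P i.1.2.2) (i.1.2.2 - i.1.2.1), l₀ (embIter (i.1.2.2 - i.1.2.1) y) = cf y) →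
      ∀ a : ℝ, a₀ * (c₀ L / cB L) * ((i.1.1.L : ℝ) ^ (i.1.2.2 - i.1.2.1)) ^ 3 ≤ a → a ≤ a₁ * (c₀ L / cB L) * ((i.1.1.L : ℝ) ^ (i.1.2.2 - i.1.2.1)) ^ 3 →
      ∀ (b : PBond (i.1.1.P i.1.2.2) 0) (Z : Matrix (Fin 2) (Fin 2) ℂ) (bd : PBond (i.1.1.P i.1.2.2) 0),
        ‖(toL2 i.1.1 i.1.2.2 (c₀ L)).symm (LinearMap.adjoint (Qk i.1.1 i.1.2.1 i.1.2.2 i.2.2.le (c₀ L) (cB L) U₀) (KinvT i.1.1 i.1.2.1 i.1.2.2 i.2.2.le (c₀ L) (cB L) a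
            (DeltaEtaSlot i.1.1 i.1.2.1 i.1.2.2 (c₀ L) + TJSlotP i.1.1 i.1.2.1 i.1.2.2 i.2.2.le (c₀ L) (cB L) a) U₀
            (Qk i.1.1 i.1.2.1 i.1.2.2 i.2.2.le (c₀ L) (cB L) U₀ (GT i.1.1 i.1.2.1 i.1.2.2 i.2.2.le (c₀ L) (cB L) a
              (DeltaEtaSlot i.1.1 i.1.2.1 i.1.2.2 (c₀ L) + TJSlotP i.1.1 i.1.2.1 i.1.2.2 i.2.2.le (c₀ L) (cB L) a) U₀ (toL2 i.1.1 i.1.2.2 (c₀ L) (Pi.single b Z)))))) bd‖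
          ≤ CC L * ((L : ℝ) ^ (i.1.2.2 - i.1.2.1))⁻¹ ^ 3
              * Real.exp (-(δC L * (Site.tdist (iterBlockOf (i.1.2.2 - i.1.2.1) b.src) (iterBlockOf (i.1.2.2 - i.1.2.1) bd.src) : ℝ))) * ‖Z‖ := by
  classical
  -- the landed ∃-packages
  obtain ⟨αJ, CJ, μJ, hαJ, hWJ12, hWJ10, hWJ13, hαJ1, hCJ, hμJ, hKJ⟩ := kinvRow_etaTJ_family_exists_allMembers c₀ cB ha₀ ha₀₁
  obtain ⟨αH, CH, δH, hαH, hWH12, hWH10, hWH13, _hαH1, hCH, hδH, h133⟩ := h133_family_exists_allMembers c₀ cB ha₀ ha₀₁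
  obtain ⟨αT, MT, hαT, hWT12, _hWT10, _hWT13, _hWT16, _hαTH, _hαT1, hMT, hT⟩ :=
    tjValueRows_family_of_h133_allMembers c₀ cB αH CH δH hαH hWH12 hWH10 hWH13 hCH hδH h133
  obtain ⟨αc, γr, hαc, _hWc12, _hWc13, hαcT, _hγr, hcS⟩ := hco_DeltaEtaTJ_exists_of_tjSupLin_allMembers c₀ cB ha₀ αT MT hαT hWT12 hMT
    (fun L hL i U₀ ρ hreg hρ hl a ha hb => (hT L hL i U₀ ρ hreg hρ hl a ha hb).1)
  obtain ⟨αG, BV, δG, hαG, _hWG12, _hWG10, _hWG13, hBV, hδG, hG⟩ := blockSup_GT_DeltaEtaSlot_family c₀ cB ha₀ ha₀₁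
  obtain ⟨αco, γco, hαco, _hWco, _hwinco, hγco, hco⟩ := hco_DeltaEtaSlot_exists c₀ cB ha₀
  -- the common rate `δ := min μJ (δG∕2)` (the column at `δ`, rate loss `ν := δG∕2`; the coarse row lowered from `μJ`)
  set δ : ℕ → ℝ := fun L => min (μJ L) (δG L / 2) with hδd
  have hδ0 : ∀ L : ℕ, 1 < L → 0 < δ L := fun L hL => by simp only [hδd]; exact lt_min (hμJ L hL) (half_pos (hδG L hL))
  have hδJ : ∀ L : ℕ, δ L ≤ μJ L := fun L => min_le_left _ _
  have hδν : ∀ L : ℕ, δ L + δG L / 2 ≤ δG L := fun L => by have := min_le_right (μJ L) (δG L / 2); simp only [hδd]; linarith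
  -- (F)'s window modulus `N` (per unit radius) and the cap
  set N : ℕ → ℝ := fun L => 2 * (BV L * (2 * (1 + 1 / (δG L / 2))) ^ 3) * (MT L * Real.exp (δ L)) with hNd
  have hN0 : ∀ L : ℕ, 1 < L → 0 ≤ N L := fun L hL => by
    have := hBV L hL; have := hMT L hL; have := hδG L hL; simp only [hNd]; positivity
  set αC : ℕ → ℝ := fun L => min (min (min (αJ L) (αG L)) (min (αco L) (αc L))) (N L + 1)⁻¹ with hαC
  have hαC0 : ∀ L : ℕ, 1 < L → 0 < αC L := fun L hL => by
    have := hαJ L hL; have := hαG L hL; have := hαco L hL; have := hαc L hL; have := hN0 L hL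
    simp only [hαC]
    exact lt_min (lt_min (lt_min (by assumption) (by assumption)) (lt_min (by assumption) (by assumption))) (by positivity)
  have hαCJ : ∀ L, αC L ≤ αJ L := fun L => by simp only [hαC]; exact (min_le_left _ _).trans ((min_le_left _ _).trans (min_le_left _ _))
  have hαCG : ∀ L, αC L ≤ αG L := fun L => by simp only [hαC]; exact (min_le_left _ _).trans ((min_le_left _ _).trans (min_le_right _ _))
  have hαCco : ∀ L, αC L ≤ αco L := fun L => by simp only [hαC]; exact (min_le_left _ _).trans ((min_le_right _ _).trans (min_le_left _ _))
  have hαCc : ∀ L, αC L ≤ αc L := fun L => by simp only [hαC]; exact (min_le_left _ _).trans ((min_le_right _ _).trans (min_le_right _ _))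
  have hαCT : ∀ L, 1 < L → αC L ≤ αT L := fun L hL => (hαCc L).trans (hαcT L hL)
  have hαCN : ∀ L, αC L ≤ (N L + 1)⁻¹ := fun L => by simp only [hαC]; exact min_le_right _ _
  have hW12 : ∀ L : ℕ, 1 < L → 10 ^ 12 * (L : ℝ) ^ 3 * αC L ≤ 1 := fun L hL => by
    have hL0 : (0 : ℝ) < L := by exact_mod_cast lt_trans zero_lt_one hL
    exact (mul_le_mul_of_nonneg_left (hαCJ L) (by positivity)).trans (hWJ12 L hL)
  have hW10 : ∀ L : ℕ, 1 < L → 10 ^ 10 * (L : ℝ) ^ 6 * αC L ≤ 1 := fun L hL => by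
    have hL0 : (0 : ℝ) < L := by exact_mod_cast lt_trans zero_lt_one hL
    exact (mul_le_mul_of_nonneg_left (hαCJ L) (by positivity)).trans (hWJ10 L hL)
  have hW13 : ∀ L : ℕ, 1 < L → 13 * 10 ^ 14 * (L : ℝ) ^ 3 * αC L ≤ 1 := fun L hL => by
    have hL0 : (0 : ℝ) < L := by exact_mod_cast lt_trans zero_lt_one hL
    exact (mul_le_mul_of_nonneg_left (hαCJ L) (by positivity)).trans (hWJ13 L hL)
  -- (F)'s window `BV·V·(αC·MT·e^{δ}) = αC·N∕2 ≤ ½`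
  have hwinF : ∀ L : ℕ, 1 < L → BV L * (2 * (1 + 1 / (δG L / 2))) ^ 3 * (αC L * MT L * Real.exp (δ L)) ≤ 1 / 2 := by
    intro L hL
    have hN := hN0 L hL
    have e : BV L * (2 * (1 + 1 / (δG L / 2))) ^ 3 * (αC L * MT L * Real.exp (δ L)) = αC L * N L / 2 := by simp only [hNd]; ring
    rw [e]
    have h1 : αC L * N L ≤ (N L + 1)⁻¹ * N L := mul_le_mul_of_nonneg_right (hαCN L) hN
    have h2 : (N L + 1)⁻¹ * N L < 1 := by rw [inv_mul_lt_iff₀ (by linarith)]; linarith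
    linarith
  have hCG0 : ∀ L : ℕ, 1 < L → 0 ≤ 4 * (BV L * (2 * (1 + 1 / (δG L / 2))) ^ 3) := fun L hL => by
    have := hBV L hL; have := hδG L hL; positivity
  refine ⟨αC, fun L => 28800 * Real.exp (δ L / 2 + 1) * (1 + Real.exp (δ L)) * CJ L * (4 * (BV L * (2 * (1 + 1 / (δG L / 2))) ^ 3)) * (2 * (1 + 2 / δ L)) ^ 3,
    fun L => δ L / 2, hαC0, hW12, hW10, hW13, fun L hL => (hαCJ L).trans (hαJ1 L hL),
    fun L hL => by have := hCJ L hL; have := hCG0 L hL; have := hδ0 L hL; positivity, fun L hL => half_pos (hδ0 L hL), ?_⟩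
  intro L hL i U₀ ρ hreg hρ hlift a ha₀a ha₁a b Z bd
  -- the clamped coupling function
  obtain ⟨af, haf⟩ : ∃ f : ∀ L' : ℕ, Idx L' → ℝ, ∀ (L' : ℕ) (i' : Idx L'),
      f L' i' = max (a₀ * (c₀ L' / cB L') * ((i'.1.1.L : ℝ) ^ (i'.1.2.2 - i'.1.2.1)) ^ 3) (min a (a₁ * (c₀ L' / cB L') * ((i'.1.1.L : ℝ) ^ (i'.1.2.2 - i'.1.2.1)) ^ 3)) :=
    ⟨_, fun _ _ => rfl⟩
  have ht0 : ∀ (L' : ℕ) (i' : Idx L'), 0 ≤ (c₀ L' / cB L') * ((i'.1.1.L : ℝ) ^ (i'.1.2.2 - i'.1.2.1)) ^ 3 := fun L' i' =>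
    mul_nonneg (div_nonneg (hc₀ L').out.le (hcB L').out.le) (pow_nonneg (pow_nonneg (Nat.cast_nonneg _) _) _)
  have haf_lo : ∀ (L' : ℕ) (i' : Idx L'), a₀ * (c₀ L' / cB L') * ((i'.1.1.L : ℝ) ^ (i'.1.2.2 - i'.1.2.1)) ^ 3 ≤ af L' i' := fun L' i' => by rw [haf]; exact le_max_left _ _
  have haf_hi : ∀ (L' : ℕ) (i' : Idx L'), af L' i' ≤ a₁ * (c₀ L' / cB L') * ((i'.1.1.L : ℝ) ^ (i'.1.2.2 - i'.1.2.1)) ^ 3 := fun L' i' => by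
    rw [haf]
    refine max_le ?_ (min_le_right _ _)
    have := ht0 L' i'
    rw [mul_assoc, mul_assoc]; exact mul_le_mul_of_nonneg_right ha₀₁ this
  have hafa : af L i = a := by rw [haf, min_eq_left ha₁a, max_eq_right ha₀a]
  have haf0 : ∀ (L' : ℕ) (i' : Idx L'), 0 ≤ af L' i' := fun L' i' => le_trans (by have := ht0 L' i'; rw [mul_assoc]; positivity) (haf_lo L' i')
  -- the thread `Lift`
  obtain ⟨Λ, hΛ⟩ : ∃ Λ : ∀ (L' : ℕ) (i' : Idx L'), GaugeField (i'.1.1.P i'.1.2.2) 0 (Matrix.specialUnitaryGroup (Fin 2) ℂ) → Prop, ∀ L' i' U₀', Λ L' i' U₀' ↔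
      ((∀ cf : Site (i'.1.1.P i'.1.2.2) (i'.1.2.2 - i'.1.2.1) → Matrix (Fin 2) (Fin 2) ℂ,
        (∀ e' : PBond (i'.1.1.P i'.1.2.2) (i'.1.2.2 - i'.1.2.1), cf e'.src = ((emlIterU (i'.1.2.2 - i'.1.2.1) (bgUnits i'.1.1 i'.1.2.2 U₀') e' : (Matrix (Fin 2) (Fin 2) ℂ)ˣ) : Matrix (Fin 2) (Fin 2) ℂ) * cf e'.tgt *
        (((emlIterU (i'.1.2.2 - i'.1.2.1) (bgUnits i'.1.1 i'.1.2.2 U₀') e')⁻¹ : (Matrix (Fin 2) (Fin 2) ℂ)ˣ) : Matrix (Fin 2) (Fin 2) ℂ)) →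
        ∃ l₀ : Site (i'.1.1.P i'.1.2.2) 0 → Matrix (Fin 2) (Fin 2) ℂ,
        (∀ b' : PBond (i'.1.1.P i'.1.2.2) 0, l₀ b'.src = ((bgUnits i'.1.1 i'.1.2.2 U₀' b' : (Matrix (Fin 2) (Fin 2) ℂ)ˣ) : Matrix (Fin 2) (Fin 2) ℂ) * l₀ b'.tgt * (((bgUnits i'.1.1 i'.1.2.2 U₀' b')⁻¹ : (Matrix (Fin 2) (Fin 2) ℂ)ˣ) : Matrix (Fin 2) (Fin 2) ℂ)) ∧
        ∀ y : Site (i'.1.1.P i'.1.2.2) (i'.1.2.2 - i'.1.2.1), l₀ (embIter (i'.1.2.2 - i'.1.2.1) y) = cf y)) := ⟨_, fun _ _ _ => Iff.rfl⟩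
  -- the windows of record at each member under the cap
  have hw13 : ∀ (L' : ℕ), 1 < L' → ∀ (i' : Idx L') (ρ' : ℝ), ρ' ≤ αC L' → 13 * 10 ^ 14 * (i'.1.1.L : ℝ) ^ 3 * ρ' ≤ 1 := by
    intro L' hL' i' ρ' hρ'
    have e : (i'.1.1.L : ℝ) = (L' : ℝ) := by rw [i'.2.1]
    have hL0 : (0 : ℝ) < L' := by exact_mod_cast lt_trans zero_lt_one hL'
    rw [e]
    calc 13 * 10 ^ 14 * (L' : ℝ) ^ 3 * ρ' ≤ 13 * 10 ^ 14 * (L' : ℝ) ^ 3 * αC L' := mul_le_mul_of_nonneg_left hρ' (by positivity)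
      _ ≤ 1 := hW13 L' hL'
  have hw12 : ∀ (L' : ℕ), 1 < L' → ∀ (i' : Idx L'), 10 ^ 12 * (i'.1.1.L : ℝ) ^ 3 * αC L' ≤ 1 := by
    intro L' hL' i'
    have e : (i'.1.1.L : ℝ) = (L' : ℝ) := by rw [i'.2.1]
    rw [e]; exact hW12 L' hL'
  -- the C-door at the slot family `S_J`
  have key := kernelC_family_of_kinvRow_of_greenColumn αC hαC0 hW10 hW12 c₀ cB af
    (fun L' i' => DeltaEtaSlot i'.1.1 i'.1.2.1 i'.1.2.2 (c₀ L') + TJSlotP i'.1.1 i'.1.2.1 i'.1.2.2 i'.2.2.le (c₀ L') (cB L') (af L' i')) Λ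
    CJ (fun L' => 4 * (BV L' * (2 * (1 + 1 / (δG L' / 2))) ^ 3)) δ hCJ hCG0 hδ0
    (fun L' hL' i' U₀' ρ' hreg' hρ' hl' => coarseRow_mono_rate i'.2.2.le (cB L') _
      (mul_nonneg (hCJ L' hL') (by have hL0 : (0 : ℝ) < L' := Nat.cast_pos.mpr (lt_trans zero_lt_one hL'); have := (hc₀ L').out; have := (hcB L').out; positivity)) (hδJ L')
      (hKJ L' hL' i' U₀' ρ' hreg' (hρ'.trans (hαCJ L')) ((hΛ L' i' U₀').mp hl') (af L' i') (haf_lo L' i') (haf_hi L' i')))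
    (fun L' hL' i' U₀' ρ' hreg' hρ' hl' =>
      blockColumn_GT_etaTJ_of_blockLetter_of_supRow i'.1.1 i'.2.2.le (c₀ L') (cB L') (hαC0 L' hL') (hw12 L' hL' i') U₀' (regPr_mono (F := i'.1.1) hρ' hreg') (haf0 L' i')
        (posOnto_of_coercive i'.2.2.le (cB L') i'.2.2 hreg' (hw13 L' hL' i' ρ' hρ') (hγco L' hL') _
          (hco L' hL' i' U₀' ρ' hreg' (hρ'.trans (hαCco L')) ((hΛ L' i' U₀').mp hl') (af L' i') (haf_lo L' i')))
        ((hcS L' hL' i' U₀' ρ' hreg' (hρ'.trans (hαCc L')) ((hΛ L' i' U₀').mp hl') (af L' i') (haf_lo L' i') (haf_hi L' i')).2.1)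
        (hBV L' hL') (mul_nonneg (hαC0 L' hL').le (hMT L' hL')) (hδ0 L' hL').le (half_pos (hδG L' hL')) (hδν L')
        (hG L' hL' i' U₀' ρ' hreg' (hρ'.trans (hαCG L')) ((hΛ L' i' U₀').mp hl') (af L' i') (haf_lo L' i') (haf_hi L' i'))
        ((hT L' hL' i' U₀' ρ' hreg' (hρ'.trans (hαCT L' hL')) ((hΛ L' i' U₀').mp hl') (af L' i') (haf_lo L' i') (haf_hi L' i')).1
          (αC L') (hαC0 L' hL').le (hαCT L' hL') (regPr_mono (F := i'.1.1) hρ' hreg'))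
        (hwinF L' hL'))
    L hL i U₀ ρ hreg hρ ((hΛ L i U₀).mpr hlift) b Z bd
  rw [hafa] at key
  exact key

/-! ## §3 Row (8) `h137kΔ` at `S_J` for all members, `∃`-packaged -/

/-- ★★★ **THE S47 ROW `h137kΔ` AT THE J-SLOT FOR ALL MEMBERS AS ONE `∃`-PACKAGE** — px10 g13's 137-door ✓`kernel137_family_of_kinvRow` at `Δx := DeltaEtaSlot … + TJSlotP … a` fed K6-J
✓`kinvRow_etaTJ_family_exists_allMembers`; the coupling pin `|a| ≤ a₁·((c₀ L∕cB L)·ℓ³)` is the window's upper edge; `CKΔ L := 1920·e^{μJ L+1}·(CJ L + a₁)`, rate `μJ L`.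
[cite: Balaban1985Variational, (133), (137) p.298; Balaban1985BackgroundPropagators, (3.132) p.422, (3.124)–(3.126) p.420] -/
theorem h137kDelta_family_exists_allMembers [hFL : ∀ F : T3Family, Fact (0 < (F.L : ℝ))] [hFη : ∀ (F : T3Family) (k : ℕ), Fact (0 < ((F.L : ℝ)⁻¹) ^ k)]
    (c₀ cB : ℕ → ℝ) [hc₀ : ∀ L : ℕ, Fact (0 < c₀ L)] [hcB : ∀ L : ℕ, Fact (0 < cB L)] {a₀ a₁ : ℝ} (ha₀ : 0 < a₀) (ha₀₁ : a₀ ≤ a₁) :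
    ∃ (αD CKΔ δKΔ : ℕ → ℝ),
      (∀ L : ℕ, 1 < L → 0 < αD L) ∧ (∀ L : ℕ, 1 < L → 10 ^ 12 * (L : ℝ) ^ 3 * αD L ≤ 1) ∧ (∀ L : ℕ, 1 < L → 10 ^ 10 * (L : ℝ) ^ 6 * αD L ≤ 1) ∧
      (∀ L : ℕ, 1 < L → 13 * 10 ^ 14 * (L : ℝ) ^ 3 * αD L ≤ 1) ∧ (∀ L : ℕ, 1 < L → αD L ≤ 1) ∧ (∀ L : ℕ, 1 < L → 0 ≤ CKΔ L) ∧ (∀ L : ℕ, 1 < L → 0 < δKΔ L) ∧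
    ∀ (L : ℕ), 1 < L → ∀ (i : Idx L) (U₀ : GaugeField (i.1.1.P i.1.2.2) 0 (Matrix.specialUnitaryGroup (Fin 2) ℂ)), ∀ ρ : ℝ, RegPr i.1.1 i.1.2.1 i.1.2.2 ρ U₀ → ρ ≤ αD L →
        (∀ cf : Site (i.1.1.P i.1.2.2) (i.1.2.2 - i.1.2.1) → Matrix (Fin 2) (Fin 2) ℂ,
        (∀ e' : PBond (i.1.1.P i.1.2.2) (i.1.2.2 - i.1.2.1), cf e'.src = ((emlIterU (i.1.2.2 - i.1.2.1) (bgUnits i.1.1 i.1.2.2 U₀) e' : (Matrix (Fin 2) (Fin 2) ℂ)ˣ) : Matrix (Fin 2) (Fin 2) ℂ) * cf e'.tgt *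
        (((emlIterU (i.1.2.2 - i.1.2.1) (bgUnits i.1.1 i.1.2.2 U₀) e')⁻¹ : (Matrix (Fin 2) (Fin 2) ℂ)ˣ) : Matrix (Fin 2) (Fin 2) ℂ)) →
        ∃ l₀ : Site (i.1.1.P i.1.2.2) 0 → Matrix (Fin 2) (Fin 2) ℂ,
        (∀ b' : PBond (i.1.1.P i.1.2.2) 0, l₀ b'.src = ((bgUnits i.1.1 i.1.2.2 U₀ b' : (Matrix (Fin 2) (Fin 2) ℂ)ˣ) : Matrix (Fin 2) (Fin 2) ℂ) * l₀ b'.tgt * (((bgUnits i.1.1 i.1.2.2 U₀ b')⁻¹ : (Matrix (Fin 2) (Fin 2) ℂ)ˣ) : Matrix (Fin 2) (Fin 2) ℂ)) ∧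
        ∀ y : Site (i.1.1.P i.1.2.2) (i.1.2.2 - i.1.2.1), l₀ (embIter (i.1.2.2 - i.1.2.1) y) = cf y) →
      ∀ a : ℝ, a₀ * (c₀ L / cB L) * ((i.1.1.L : ℝ) ^ (i.1.2.2 - i.1.2.1)) ^ 3 ≤ a → a ≤ a₁ * (c₀ L / cB L) * ((i.1.1.L : ℝ) ^ (i.1.2.2 - i.1.2.1)) ^ 3 →
      ∀ (y : PBond (i.1.1.P i.1.2.1) 0) (Z : Matrix (Fin 2) (Fin 2) ℂ) (b : PBond (i.1.1.P i.1.2.2) 0),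
        ‖(toL2 i.1.1 i.1.2.2 (c₀ L)).symm (LinearMap.adjoint (Qk i.1.1 i.1.2.1 i.1.2.2 i.2.2.le (c₀ L) (cB L) U₀) (KinvT i.1.1 i.1.2.1 i.1.2.2 i.2.2.le (c₀ L) (cB L) a
              (DeltaEtaSlot i.1.1 i.1.2.1 i.1.2.2 (c₀ L) + TJSlotP i.1.1 i.1.2.1 i.1.2.2 i.2.2.le (c₀ L) (cB L) a) U₀ (toL2B i.1.1 i.1.2.1 (cB L) (Pi.single y Z)))
            - LinearMap.adjoint (Qk i.1.1 i.1.2.1 i.1.2.2 i.2.2.le (c₀ L) (cB L) U₀) (((a : ℂ)) • toL2B i.1.1 i.1.2.1 (cB L) (Pi.single y Z))) b‖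
          ≤ CKΔ L * Real.exp (-(δKΔ L * (Site.tdist (iterBlockOf (i.1.2.2 - i.1.2.1) b.src) (siteShift (sites_eq i.1.1 i.1.2.1 i.1.2.2 i.2.2.le) y.src) : ℝ))) * ‖Z‖ := by
  classical
  obtain ⟨αJ, CJ, μJ, hαJ, hWJ12, hWJ10, hWJ13, hαJ1, hCJ, hμJ, hKJ⟩ := kinvRow_etaTJ_family_exists_allMembers c₀ cB ha₀ ha₀₁
  have ha₁ : 0 ≤ a₁ := ha₀.le.trans ha₀₁
  refine ⟨αJ, fun L => 1920 * Real.exp (μJ L + 1) * (CJ L + a₁), μJ, hαJ, hWJ12, hWJ10, hWJ13, hαJ1,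
    fun L hL => by have := hCJ L hL; positivity, hμJ, ?_⟩
  intro L hL i U₀ ρ hreg hρ hlift a ha₀a ha₁a y Z b
  -- the clamped coupling function
  obtain ⟨af, haf⟩ : ∃ f : ∀ L' : ℕ, Idx L' → ℝ, ∀ (L' : ℕ) (i' : Idx L'),
      f L' i' = max (a₀ * (c₀ L' / cB L') * ((i'.1.1.L : ℝ) ^ (i'.1.2.2 - i'.1.2.1)) ^ 3) (min a (a₁ * (c₀ L' / cB L') * ((i'.1.1.L : ℝ) ^ (i'.1.2.2 - i'.1.2.1)) ^ 3)) :=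
    ⟨_, fun _ _ => rfl⟩
  have ht0 : ∀ (L' : ℕ) (i' : Idx L'), 0 ≤ (c₀ L' / cB L') * ((i'.1.1.L : ℝ) ^ (i'.1.2.2 - i'.1.2.1)) ^ 3 := fun L' i' =>
    mul_nonneg (div_nonneg (hc₀ L').out.le (hcB L').out.le) (pow_nonneg (pow_nonneg (Nat.cast_nonneg _) _) _)
  have haf_lo : ∀ (L' : ℕ) (i' : Idx L'), a₀ * (c₀ L' / cB L') * ((i'.1.1.L : ℝ) ^ (i'.1.2.2 - i'.1.2.1)) ^ 3 ≤ af L' i' := fun L' i' => by rw [haf]; exact le_max_left _ _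
  have haf_hi : ∀ (L' : ℕ) (i' : Idx L'), af L' i' ≤ a₁ * (c₀ L' / cB L') * ((i'.1.1.L : ℝ) ^ (i'.1.2.2 - i'.1.2.1)) ^ 3 := fun L' i' => by
    rw [haf]
    refine max_le ?_ (min_le_right _ _)
    have := ht0 L' i'
    rw [mul_assoc, mul_assoc]; exact mul_le_mul_of_nonneg_right ha₀₁ this
  have hafa : af L i = a := by rw [haf, min_eq_left ha₁a, max_eq_right ha₀a]
  have haf0 : ∀ (L' : ℕ) (i' : Idx L'), 0 ≤ af L' i' := fun L' i' => le_trans (by have := ht0 L' i'; rw [mul_assoc]; positivity) (haf_lo L' i')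
  have hafU : ∀ (L' : ℕ), 1 < L' → ∀ i' : Idx L', |af L' i'| ≤ a₁ * ((c₀ L' / cB L') * ((L' : ℝ) ^ (i'.1.2.2 - i'.1.2.1)) ^ 3) := fun L' _ i' => by
    have e : (i'.1.1.L : ℝ) = (L' : ℝ) := by rw [i'.2.1]
    have := haf_hi L' i'
    rw [e, mul_assoc] at this; rw [abs_of_nonneg (haf0 L' i')]; exact this
  -- the thread `Lift`
  obtain ⟨Λ, hΛ⟩ : ∃ Λ : ∀ (L' : ℕ) (i' : Idx L'), GaugeField (i'.1.1.P i'.1.2.2) 0 (Matrix.specialUnitaryGroup (Fin 2) ℂ) → Prop, ∀ L' i' U₀', Λ L' i' U₀' ↔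
      ((∀ cf : Site (i'.1.1.P i'.1.2.2) (i'.1.2.2 - i'.1.2.1) → Matrix (Fin 2) (Fin 2) ℂ,
        (∀ e' : PBond (i'.1.1.P i'.1.2.2) (i'.1.2.2 - i'.1.2.1), cf e'.src = ((emlIterU (i'.1.2.2 - i'.1.2.1) (bgUnits i'.1.1 i'.1.2.2 U₀') e' : (Matrix (Fin 2) (Fin 2) ℂ)ˣ) : Matrix (Fin 2) (Fin 2) ℂ) * cf e'.tgt *
        (((emlIterU (i'.1.2.2 - i'.1.2.1) (bgUnits i'.1.1 i'.1.2.2 U₀') e')⁻¹ : (Matrix (Fin 2) (Fin 2) ℂ)ˣ) : Matrix (Fin 2) (Fin 2) ℂ)) →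
        ∃ l₀ : Site (i'.1.1.P i'.1.2.2) 0 → Matrix (Fin 2) (Fin 2) ℂ,
        (∀ b' : PBond (i'.1.1.P i'.1.2.2) 0, l₀ b'.src = ((bgUnits i'.1.1 i'.1.2.2 U₀' b' : (Matrix (Fin 2) (Fin 2) ℂ)ˣ) : Matrix (Fin 2) (Fin 2) ℂ) * l₀ b'.tgt * (((bgUnits i'.1.1 i'.1.2.2 U₀' b')⁻¹ : (Matrix (Fin 2) (Fin 2) ℂ)ˣ) : Matrix (Fin 2) (Fin 2) ℂ)) ∧
        ∀ y : Site (i'.1.1.P i'.1.2.2) (i'.1.2.2 - i'.1.2.1), l₀ (embIter (i'.1.2.2 - i'.1.2.1) y) = cf y)) := ⟨_, fun _ _ _ => Iff.rfl⟩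
  have key := kernel137_family_of_kinvRow αJ hαJ hWJ10 hWJ12 c₀ cB af (fun _ => a₁) (fun _ _ => ha₁) hafU
    (fun L' i' => DeltaEtaSlot i'.1.1 i'.1.2.1 i'.1.2.2 (c₀ L') + TJSlotP i'.1.1 i'.1.2.1 i'.1.2.2 i'.2.2.le (c₀ L') (cB L') (af L' i')) Λ CJ μJ hCJ hμJ
    (fun L' hL' i' U₀' ρ' hreg' hρ' hl' => hKJ L' hL' i' U₀' ρ' hreg' hρ' ((hΛ L' i' U₀').mp hl') (af L' i') (haf_lo L' i') (haf_hi L' i'))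
    L hL i U₀ ρ hreg hρ ((hΛ L i U₀).mpr hlift) y Z b
  rw [hafa] at key
  exact key

end Family

end Summit.QuantumFields.YangMills.Theorems.Prop7KRows78EtaTJFamilyPackageAllMembers

end
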